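import Summits.FinalStateConjecture.FinalStateConjecture.Theorems.KerrShieldedDataExist.Negative.BentHeight
import Literature.NumberTheory.Sieve.GreenTao2008PseudorandomMajorantProofs
import Mathlib.Analysis.Complex.ExponentialBounds
import HarnessLib

/-!
# `KerrShieldedDataExist` — slope bounds for the bent height on the transition annulus (part 2 of 3)

Support lemmas for crux `stmt-FinalStateConjecture-10055` (route SwallowTheDatum), continuing
`BentHeight.lean`: on `[4M, ∞)`, `0 ≤ T′(r) ≤ log((r − 2M)/2M) + 2M/(r − 2M)` UNIFORMLY in the spin
`|a| < M` (ingredients: `0 ≤ χ′ ≤ 2`, `0 ≤ χ ≤ 1`, the tortoise comparison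
`F(r) − F(4M) ≤ 2M log((r − 2M)/2M)` — the comparison height `2M log(r − 2M) − F` has derivative
`2M a²/((r − 2M)Δ) ≥ 0` — and `Δ ≥ r(r − 2M)`), and the three window caps
`T′ < 17/10` on `(4M, 6M]`, `T′ < 3/2` on `[6M, 7M]`, `T′ < 8/5` on `[7M, 8M]` from
`log 2 < 0.6932`, `log(5/2) < 1`, `log 3 < 1.1932`. Numerically `max T′ = 1.078` (`r ≈ 6.52M`, `a = 0`).
The bounds `0 ≤ χ′ ≤ 2` are the tree's `deriv_smoothTransition_nonneg` / `deriv_smoothTransition_le_two`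
(`Literature.NumberTheory.Sieve.GreenTao2008PseudorandomMajorantProofs`, where they were first proved).
References: Dafermos–Rodnianski arXiv:0811.0354 §5.1.
-/

noncomputable section

open Real Set Filter Topology
open scoped Manifold ContDiff
open Literature.Geometry.Lorentzian
open Literature.NumberTheory.Sieve.GreenTao2008 (deriv_smoothTransition_nonneg deriv_smoothTransition_le_two)
open Literature.Analysis.Calculus (differentiable_smoothTransition deriv_smoothTransition_of_nonpos
  deriv_smoothTransition_of_one_le)

namespace Summit.FinalStateConjecture.FinalStateConjecture.Theorems.KerrShieldedDataExist.Negative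

/-! ## §4 Slope bounds on the transition annulus `4M ≤ r ≤ 8M` -/

section SlopeBounds

variable {M a : ℝ}

/-- `F` is differentiable on `[4M, ∞)` (which lies above `r₊`). [folklore] -/
theorem differentiableOn_blHeight (h : |a| < M) :
    DifferentiableOn ℝ (blHeight M a) (Ici (4 * M)) := fun _ hx =>
  (hasDerivAt_blHeight h ((rPlus_lt_four_mul h).trans_le hx)).differentiableAt.differentiableWithinAt

/-- `F` is monotone on `[4M, ∞)` (`F′ = 2Mr/Δ > 0`). [folklore] -/
theorem monotoneOn_blHeight (h : |a| < M) : MonotoneOn (blHeight M a) (Ici (4 * M)) := by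
  have hM := mass_pos h
  refine monotoneOn_of_deriv_nonneg (convex_Ici _) (differentiableOn_blHeight h).continuousOn
    ((differentiableOn_blHeight h).mono interior_subset) fun x hx => ?_
  rw [interior_Ici] at hx
  have hx4 : 4 * M < x := hx
  have hx' : Kerr.rPlus M a < x := (rPlus_lt_four_mul h).trans hx4
  rw [(hasDerivAt_blHeight h hx').deriv]
  have := delta_pos h hx'
  have : 0 < x := by linarith
  positivity

/-- `0 ≤ F(r) − F(4M)` for `4M ≤ r`. [folklore] -/
theorem blHeight_sub_nonneg (h : |a| < M) {r : ℝ} (hr : 4 * M ≤ r) :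
    0 ≤ blHeight M a r - blHeight M a (4 * M) :=
  sub_nonneg.2 (monotoneOn_blHeight h Set.self_mem_Ici hr hr)

/-- The comparison height `G(r) = 2M log(r − 2M) − F(r)` has `G′ = 2M a²/((r − 2M) Δ) ≥ 0` above `4M`,
whence **`F(r) − F(4M) ≤ 2M log((r − 2M)/(2M))`** (the Schwarzschild tortoise bound, uniform in `a`).
[folklore] -/
theorem blHeight_sub_le (h : |a| < M) {r : ℝ} (hr : 4 * M ≤ r) :
    blHeight M a r - blHeight M a (4 * M) ≤ 2 * M * Real.log ((r - 2 * M) / (2 * M)) := by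
  have hM := mass_pos h
  set G : ℝ → ℝ := fun x => 2 * M * Real.log (x - 2 * M) - blHeight M a x with hG
  have hderiv : ∀ x, 4 * M ≤ x → HasDerivAt G
      (2 * M * (1 / (x - 2 * M)) - 2 * M * x / (x ^ 2 - 2 * M * x + a ^ 2)) x := by
    intro x hx
    have hx2 : x - 2 * M ≠ 0 := by
      have : 0 < x - 2 * M := by linarith
      exact this.ne'
    have h1 : HasDerivAt (fun y => Real.log (y - 2 * M)) (1 / (x - 2 * M)) x := by
      simpa using ((hasDerivAt_id' x).sub_const (2 * M)).log hx2
    exact (h1.const_mul (2 * M)).sub (hasDerivAt_blHeight h ((rPlus_lt_four_mul h).trans_le hx))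
  have hdiff : DifferentiableOn ℝ G (Ici (4 * M)) := fun x hx =>
    (hderiv x (show 4 * M ≤ x from hx)).differentiableAt.differentiableWithinAt
  have hmono : MonotoneOn G (Ici (4 * M)) := by
    refine monotoneOn_of_deriv_nonneg (convex_Ici _) hdiff.continuousOn
      (hdiff.mono interior_subset) fun x hx => ?_
    rw [interior_Ici] at hx
    have hx4 : 4 * M < x := hx
    rw [(hderiv x hx4.le).deriv]
    have hΔ : 0 < x ^ 2 - 2 * M * x + a ^ 2 := delta_pos h ((rPlus_lt_four_mul h).trans hx4)
    have hx2 : 0 < x - 2 * M := by linarith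
    rw [sub_nonneg, div_le_iff₀ hΔ, mul_one_div, div_mul_eq_mul_div, le_div_iff₀ hx2]
    nlinarith [sq_nonneg a, hM.le]
  have key := hmono Set.self_mem_Ici hr hr
  simp only [hG] at key
  have h2M : (0:ℝ) < 2 * M := by linarith
  have hr2 : 0 < r - 2 * M := by linarith
  rw [Real.log_div hr2.ne' h2M.ne']
  have e : (4 * M - 2 * M) = 2 * M := by ring
  rw [e] at key
  nlinarith [key]

/-- **`T′ ≥ 0`** everywhere (each factor of each term is nonnegative). [folklore] -/
theorem bentSlope_nonneg (h : |a| < M) (r : ℝ) : 0 ≤ bentSlope M a r := by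
  have hM := mass_pos h
  rcases le_or_gt r (4 * M) with hr | hr
  · rw [bentSlope_eq_zero_of_le hM hr]
  · have h1 := deriv_smoothTransition_nonneg (r / (4 * M) - 1)
    have h2 := blHeight_sub_nonneg h hr.le
    have h3 := Real.smoothTransition.nonneg (r / (4 * M) - 1)
    have h4 : 0 ≤ 2 * M * r / (r ^ 2 - 2 * M * r + a ^ 2) :=
      div_nonneg (by nlinarith) (delta_pos h ((rPlus_lt_four_mul h).trans hr)).le
    unfold bentSlope
    positivity

/-- `2Mr/Δ ≤ 2M/(r − 2M)` for `r > 2M` (`Δ ≥ r(r − 2M)`). [folklore] -/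
theorem blSlope_le (h : |a| < M) {r : ℝ} (hr : 2 * M < r) :
    2 * M * r / (r ^ 2 - 2 * M * r + a ^ 2) ≤ 2 * M / (r - 2 * M) := by
  have hM := mass_pos h
  have hr0 : 0 < r := by linarith
  have hΔ : 0 < r ^ 2 - 2 * M * r + a ^ 2 := by nlinarith [delta_ge M a r, mul_pos hr0 (sub_pos.2 hr)]
  rw [div_le_div_iff₀ hΔ (sub_pos.2 hr)]
  nlinarith [delta_ge M a r, sq_nonneg a]

/-- **The slope bound on the annulus**: for `4M ≤ r`,
`T′(r) ≤ log((r − 2M)/(2M)) + 2M/(r − 2M)` (using `χ′ ≤ 2`, `χ ≤ 1`, the tortoise bound and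
`Δ ≥ r(r − 2M)`). Numerically the right side is `≤ 1.4319` on `[4M, 8M]` (at `8M`), while
`sup T′ = 1.078` (at `r ≈ 6.52M`, `a = 0`). [folklore] -/
theorem bentSlope_le (h : |a| < M) {r : ℝ} (hr : 4 * M ≤ r) :
    bentSlope M a r ≤ Real.log ((r - 2 * M) / (2 * M)) + 2 * M / (r - 2 * M) := by
  have hM := mass_pos h
  have hd0 := deriv_smoothTransition_nonneg (r / (4 * M) - 1)
  have hd2 := deriv_smoothTransition_le_two (r / (4 * M) - 1)
  have hF0 := blHeight_sub_nonneg h hr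
  have hF := blHeight_sub_le h hr
  have hχ0 := Real.smoothTransition.nonneg (r / (4 * M) - 1)
  have hχ1 := Real.smoothTransition.le_one (r / (4 * M) - 1)
  have hs0 : 0 ≤ 2 * M * r / (r ^ 2 - 2 * M * r + a ^ 2) :=
    div_nonneg (by nlinarith) (delta_pos h ((rPlus_lt_four_mul h).trans_le hr)).le
  have hs := blSlope_le h (show 2 * M < r by linarith)
  have hL0 : 0 ≤ Real.log ((r - 2 * M) / (2 * M)) := by
    apply Real.log_nonneg
    rw [le_div_iff₀ (by linarith)]; linarith
  unfold bentSlope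
  have h1 : deriv Real.smoothTransition (r / (4 * M) - 1) / (4 * M) *
      (blHeight M a r - blHeight M a (4 * M)) ≤ Real.log ((r - 2 * M) / (2 * M)) := by
    have hA : deriv Real.smoothTransition (r / (4 * M) - 1) / (4 * M) ≤ 2 / (4 * M) :=
      div_le_div_of_nonneg_right hd2 (by linarith)
    have hA0 : 0 ≤ deriv Real.smoothTransition (r / (4 * M) - 1) / (4 * M) :=
      div_nonneg hd0 (by linarith)
    calc deriv Real.smoothTransition (r / (4 * M) - 1) / (4 * M) *
          (blHeight M a r - blHeight M a (4 * M))
        ≤ (2 / (4 * M)) * (2 * M * Real.log ((r - 2 * M) / (2 * M))) :=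
          mul_le_mul hA hF hF0 (by positivity)
      _ = Real.log ((r - 2 * M) / (2 * M)) := by field_simp; ring
  have h2 : Real.smoothTransition (r / (4 * M) - 1) * (2 * M * r / (r ^ 2 - 2 * M * r + a ^ 2)) ≤
      2 * M / (r - 2 * M) := by
    calc Real.smoothTransition (r / (4 * M) - 1) * (2 * M * r / (r ^ 2 - 2 * M * r + a ^ 2))
        ≤ 1 * (2 * M / (r - 2 * M)) := mul_le_mul hχ1 hs hs0 zero_le_one
      _ = 2 * M / (r - 2 * M) := one_mul _
  linarith

/-- `log 2 < 0.6932` (Mathlib's `Real.log_two_lt_d9`). [folklore] -/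
theorem log_two_lt : Real.log 2 < 0.6932 := by
  have := Real.log_two_lt_d9; norm_num at this ⊢; linarith

/-- `log(5/2) < 1` (from `e > 2.718`). [folklore] -/
theorem log_five_halves_lt : Real.log (5 / 2) < 1 := by
  rw [Real.log_lt_iff_lt_exp (by norm_num)]
  have := Real.exp_one_gt_d9; norm_num at this ⊢; linarith

/-- `log 3 < 1.1932` (from `log 2 < 0.6932` and `log(3/2) < 1/2`). [folklore] -/
theorem log_three_lt : Real.log 3 < 1.1932 := by
  have h32 : Real.log (3 / 2) < 1 / 2 := by
    rw [Real.log_lt_iff_lt_exp (by norm_num)]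
    have := Real.add_one_lt_exp (show (1 / 2 : ℝ) ≠ 0 by norm_num)
    norm_num at this ⊢; linarith
  have e : Real.log 3 = Real.log 2 + Real.log (3 / 2) := by
    rw [← Real.log_mul (by norm_num) (by norm_num)]; norm_num
  rw [e]; have := log_two_lt; norm_num at this h32 ⊢; linarith

/-- Window cap `T′ < 17/10` on `(4M, 6M]` (the other two windows: `bentSlope_lt_cap₂/₃`). [folklore] -/
theorem bentSlope_lt_cap₁ (h : |a| < M) {r : ℝ} (hr : 4 * M < r) (hr' : r ≤ 6 * M) :
    bentSlope M a r < 17 / 10 := by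
  have hM := mass_pos h
  have hb := bentSlope_le h hr.le
  have hL : Real.log ((r - 2 * M) / (2 * M)) ≤ Real.log 2 := by
    apply Real.log_le_log (by apply div_pos <;> linarith)
    rw [div_le_iff₀ (by linarith)]; linarith
  have hq : 2 * M / (r - 2 * M) < 1 := by
    rw [div_lt_one (by linarith)]; linarith
  have := log_two_lt
  norm_num at this ⊢; linarith

/-- Window cap `T′ < 3/2` on `[6M, 7M]`. [folklore] -/
theorem bentSlope_lt_cap₂ (h : |a| < M) {r : ℝ} (hr : 6 * M ≤ r) (hr' : r ≤ 7 * M) :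
    bentSlope M a r < 3 / 2 := by
  have hM := mass_pos h
  have hb := bentSlope_le h (by linarith)
  have hL : Real.log ((r - 2 * M) / (2 * M)) ≤ Real.log (5 / 2) := by
    apply Real.log_le_log (by apply div_pos <;> linarith)
    rw [div_le_iff₀ (by linarith)]; linarith
  have hq : 2 * M / (r - 2 * M) ≤ 1 / 2 := by
    rw [div_le_iff₀ (by linarith)]; linarith
  have := log_five_halves_lt
  linarith

/-- Window cap `T′ < 8/5` on `[7M, 8M]`. [folklore] -/
theorem bentSlope_lt_cap₃ (h : |a| < M) {r : ℝ} (hr : 7 * M ≤ r) (hr' : r ≤ 8 * M) :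
    bentSlope M a r < 8 / 5 := by
  have hM := mass_pos h
  have hb := bentSlope_le h (by linarith)
  have hL : Real.log ((r - 2 * M) / (2 * M)) ≤ Real.log 3 := by
    apply Real.log_le_log (by apply div_pos <;> linarith)
    rw [div_le_iff₀ (by linarith)]; linarith
  have hq : 2 * M / (r - 2 * M) ≤ 2 / 5 := by
    rw [div_le_iff₀ (by linarith)]; linarith
  have := log_three_lt
  norm_num at this ⊢; linarith

end SlopeBounds


end Summit.FinalStateConjecture.FinalStateConjecture.Theorems.KerrShieldedDataExist.Negative

end
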